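import Summits.QuantumFields.GaugeBoot.DiagonalRPTorusBandTerm
import HarnessLib

/-!
# The band integral, I: integrating out the middle column (gauge-boot, task L3(π), 5/7)

HONEST FRAMING (cell `pub-gaugeboot`, page 1 of every file): the venture produces certified bounds
on lattice expectations at stated coupling, gauge group, dimension and torus size; NOT a mass gap,
NOT a continuum limit, NOT a string tension; NOT Yang–Mills-summit-bearing (barriers
`FixedCouplingUltralocality`, `PerturbativeInvisibility`). This module computes part of the
leading strong-coupling coefficient used by the structural NEGATIVE result
`DiagonalRPTorusInnerHalfNegativeEvenSUN` (inner-half diagonal RP fails on even three-tori for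
`G ≅ SU(N)` at small coupling); it discharges nothing by itself.

## Content (torus `(ℤ/L)³`, vertical plane `pl = (a, 2)`, columns `B`, `M = B + e_a`,
`A = B + 2e_a`; any compact metrisable `G`, continuous `ρ`)

The band integral `bandIntegral ρ pl B = ∫ P_A P_B ∏_z Re tr ρ(U_{p_z}) Re tr ρ(U_{p'_z})`
(`p_z`, `p'_z` the rung plaquettes over `M` and over `B` at height `z`) is reduced to the
RECTANGLE INTEGRAL `rectIntegral ρ pl B = ∫ P_A P_B ∏_z Re tr ρ(R_z)`, `R_z` the holonomy of the
`2 × 1` rectangle between `A` and `B` at height `z` (`rectWord`):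
**`bandIntegral_eq_pow_mul_rectIntegral`**: `bandIntegral = c₁^L · rectIntegral` under the
character identity (R1) `∫ Re χ(x g⁻¹) Re χ(g y) dg = c₁ Re χ(x y)`, by resampling the `L` vertical
links of the middle column one at a time (`mid_succ`; each lies in exactly the two rung
plaquettes of its height; `DiagRPSUN.integral_pi_update_of_forall`).

Elementary strong-coupling bookkeeping (cf. M. Creutz, *Quarks, gluons and lattices* (1983)
§10); no named fact.
-/

open MeasureTheory Complex Finset Function
open scoped ComplexOrder

namespace Summit.QuantumFields.GaugeBoot

open Literature.MathematicalPhysics.QuantumFieldTheory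
open Literature.MathematicalPhysics.QuantumFieldTheory.PlaquetteLowerBound (reTr)
open Literature.RepresentationTheory.CompactGroups

noncomputable section

namespace DiagRPSUN

open DiagRPThree DiagRPPolyakov

section Middle

variable {L : ℕ} [NeZero L] {N : ℕ} {G : Type*} [Group G] [TopologicalSpace G]
  [IsTopologicalGroup G] [CompactSpace G] [MeasurableSpace G] [BorelSpace G]
  [SecondCountableTopology G] (ρ : G →* Matrix (Fin N) (Fin N) ℂ)
  (pl : {q : Fin 3 × Fin 3 // q.1 < q.2}) (B : ZMod L × ZMod L)

/-- The `2 × 1` RECTANGLE WORD at height `z` between `B` and `A = B + 2e_a` through `M = B + e_a`: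
`r_z s_z a_z (r_{z+1} s_{z+1})⁻¹ b_z⁻¹` with `r = U(vsite B ·, a)`, `s = U(vsite M ·, a)`,
`a_z = U(vsite A z, 2)`, `b_z = U(vsite B z, 2)`. -/
def rectWord (z : ZMod L) (U : GaugeConfig 3 L G) : G :=
  U (vsite B z, pl.1.1) * U (vsite (bump pl.1.1 B) z, pl.1.1) *
    U (vsite (bump pl.1.1 (bump pl.1.1 B)) z, 2) *
    (U (vsite B (z + 1), pl.1.1) * U (vsite (bump pl.1.1 B) (z + 1), pl.1.1))⁻¹ * (U (vsite B z, 2))⁻¹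

/-- The RECTANGLE INTEGRAL `∫ P_A P_B ∏_z Re tr ρ(R_z) ∏ dU`. -/
def rectIntegral : ℝ :=
  ∫ U, polRe ρ 2 U (vsite (bump pl.1.1 (bump pl.1.1 B)) 0) * polRe ρ 2 U (vsite B 0) *
    ∏ z : ZMod L, reTr ρ (rectWord pl B z U) ∂Measure.pi fun _ : Edge 3 L => haarProbability G

/-- The stage-`k` integrand of the middle-column integration: rectangles below height `k`, rung
pairs from height `k` on. -/
def midIntegrand (k : ℕ) (U : GaugeConfig 3 L G) : ℝ :=
  polRe ρ 2 U (vsite (bump pl.1.1 (bump pl.1.1 B)) 0) * polRe ρ 2 U (vsite B 0) *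
    (∏ i ∈ range k, reTr ρ (rectWord pl B (i : ZMod L) U)) *
    ∏ i ∈ Ico k L, (WilsonRP.plaqRe ρ U (vsite (bump pl.1.1 B) (i : ZMod L), pl) *
      WilsonRP.plaqRe ρ U (vsite B (i : ZMod L), pl))

/-! ### Continuity -/

omit [NeZero L] [IsTopologicalGroup G] [CompactSpace G] [MeasurableSpace G] [BorelSpace G]
  [SecondCountableTopology G] in
/-- The rectangle word is continuous in the configuration. -/
theorem continuous_rectWord [ContinuousMul G] [ContinuousInv G] (z : ZMod L) :
    Continuous fun U : GaugeConfig 3 L G => rectWord pl B z U := by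
  unfold rectWord
  have h := fun e : Edge 3 L => continuous_apply (A := fun _ : Edge 3 L => G) e
  exact (((((h _).mul (h _)).mul (h _)).mul ((h _).mul (h _)).inv).mul (h _).inv)

omit [NeZero L] [MeasurableSpace G] [BorelSpace G] [SecondCountableTopology G] [CompactSpace G] in
/-- The stage integrand is continuous. -/
theorem continuous_midIntegrand (hρ : Continuous ρ) (k : ℕ) :
    Continuous (midIntegrand ρ pl B k) := by
  unfold midIntegrand
  exact (((continuous_polRe ρ hρ 2 _).mul (continuous_polRe ρ hρ 2 _)).mul
    (continuous_finsetProd _ fun i _ => continuous_reTr_comp ρ hρ (continuous_rectWord pl B _))).mul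
    (continuous_finsetProd _ fun i _ => (continuous_plaqRe ρ hρ _).mul (continuous_plaqRe ρ hρ _))

/-! ### The two ends of the induction -/

omit [TopologicalSpace G] [IsTopologicalGroup G] [CompactSpace G] [MeasurableSpace G] [BorelSpace G]
  [SecondCountableTopology G] in
/-- Stage `0` is the band integrand. -/
theorem midIntegrand_zero (U : GaugeConfig 3 L G) : midIntegrand ρ pl B 0 U =
    polRe ρ 2 U (vsite (bump pl.1.1 (bump pl.1.1 B)) 0) * polRe ρ 2 U (vsite B 0) *
      ∏ z : ZMod L, (WilsonRP.plaqRe ρ U (vsite (bump pl.1.1 B) z, pl) *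
        WilsonRP.plaqRe ρ U (vsite B z, pl)) := by
  unfold midIntegrand
  rw [range_zero, prod_empty, mul_one, ← range_eq_Ico,
    prod_range_natCast (fun z => WilsonRP.plaqRe ρ U (vsite (bump pl.1.1 B) z, pl) *
      WilsonRP.plaqRe ρ U (vsite B z, pl))]

omit [TopologicalSpace G] [IsTopologicalGroup G] [CompactSpace G] [MeasurableSpace G] [BorelSpace G]
  [SecondCountableTopology G] in
/-- Stage `L` is the rectangle integrand. -/
theorem midIntegrand_last (U : GaugeConfig 3 L G) : midIntegrand ρ pl B L U =
    polRe ρ 2 U (vsite (bump pl.1.1 (bump pl.1.1 B)) 0) * polRe ρ 2 U (vsite B 0) *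
      ∏ z : ZMod L, reTr ρ (rectWord pl B z U) := by
  unfold midIntegrand
  rw [Ico_self, prod_empty, mul_one, prod_range_natCast (fun z => reTr ρ (rectWord pl B z U))]

/-! ### The inductive step: resampling the middle link at height `k` with (R1) -/

/-- **Middle step.** For `k < L`, resampling the vertical link of the middle column at height `k`
(it lies in exactly the two rung plaquettes of height `k`) with (R1) turns the stage-`k`
integrand into `c₁` times the stage-`(k+1)` integrand. -/
theorem mid_succ (hpl : pl.1.2 = 2) (hρ : Continuous ρ) (hL : 3 ≤ L) {c₁ : ℝ}
    (hR1 : ∀ x y : G, ∫ g, reTr ρ (x * g⁻¹) * reTr ρ (g * y) ∂haarProbability G =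
      c₁ * reTr ρ (x * y))
    {k : ℕ} (hkL : k < L) :
    ∫ U, midIntegrand ρ pl B k U ∂Measure.pi (fun _ : Edge 3 L => haarProbability G) =
      c₁ * ∫ U, midIntegrand ρ pl B (k + 1) U
        ∂Measure.pi (fun _ : Edge 3 L => haarProbability G) := by
  have hL1 : 1 < L := by omega
  have ha := fst_ne_two pl hpl
  set a : Fin 3 := pl.1.1 with ha_def
  set M := bump a B with hM
  set A := bump a M with hA
  have hMB : M ≠ B := bump_ne_self hL1 ha B
  have hAM : A ≠ M := bump_ne_self hL1 ha M
  have hAB : A ≠ B := bump_bump_ne_self hL ha B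
  set e : Edge 3 L := (vsite M (k : ZMod L), 2) with he
  rw [← integral_const_mul]
  refine integral_pi_update_of_forall (haarProbability G) e
    (integrable_of_continuous_config (continuous_midIntegrand ρ pl B hρ k)) fun U => ?_
  -- links not read: horizontal links, vertical links over other columns or other heights
  have hhor : ∀ (s : G) (C : ZMod L × ZMod L) (w : ZMod L), update U e s (vsite C w, a) =
      U (vsite C w, a) := fun s C w =>
    update_of_ne (fun h => ha ((congrArg Prod.snd h).trans rfl)) _ _
  have hcol : ∀ (s : G) {C : ZMod L × ZMod L} (_ : C ≠ M) (w : ZMod L),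
      update U e s (vsite C w, 2) = U (vsite C w, 2) := fun s C hC w =>
    update_of_ne (fun h => hC (vsite_eq_vsite_iff.1 (congrArg Prod.fst h)).1) _ _
  have hheight : ∀ (s : G) {w : ZMod L} (_ : w ≠ (k : ZMod L)),
      update U e s (vsite M w, 2) = U (vsite M w, 2) := fun s w hw =>
    update_of_ne (fun h => hw (vsite_eq_vsite_iff.1 (congrArg Prod.fst h)).2) _ _
  have hP : ∀ (s : G) {C : ZMod L × ZMod L} (_ : C ≠ M), polRe ρ 2 (update U e s) (vsite C 0) =
      polRe ρ 2 U (vsite C 0) := fun s C hC => by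
    unfold polRe; rw [lineHolonomy_update_of_col_ne hC]
  have hrect : ∀ (s : G) (w : ZMod L), rectWord pl B w (update U e s) = rectWord pl B w U :=
    fun s w => by
    unfold rectWord
    rw [← ha_def, ← hM, ← hA, hhor, hhor, hhor, hhor, hcol s hAM, hcol s hMB.symm]
  -- heights in `Ico (k+1) L` differ from `k` in `ℤ/L`
  have hne : ∀ i ∈ Ico (k + 1) L, (i : ZMod L) ≠ (k : ZMod L) := fun i hi h => by
    obtain ⟨hik, hiL⟩ := mem_Ico.1 hi
    have := (natCast_eq_natCast_iff_of_lt hiL hkL).1 h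
    omega
  have hpairs : ∀ s : G, ∏ i ∈ Ico (k + 1) L,
      (WilsonRP.plaqRe ρ (update U e s) (vsite M (i : ZMod L), pl) *
        WilsonRP.plaqRe ρ (update U e s) (vsite B (i : ZMod L), pl)) =
      ∏ i ∈ Ico (k + 1) L, (WilsonRP.plaqRe ρ U (vsite M (i : ZMod L), pl) *
        WilsonRP.plaqRe ρ U (vsite B (i : ZMod L), pl)) := fun s => by
    refine prod_congr rfl fun i hi => ?_
    rw [plaqRe_rung ρ pl hpl M, plaqRe_rung ρ pl hpl M, plaqRe_rung ρ pl hpl B,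
      plaqRe_rung ρ pl hpl B, ← ha_def, ← hM, ← hA, hhor, hhor, hhor, hhor, hcol s hAM,
      hheight s (hne i hi), hcol s hMB.symm]
  -- the two rung plaquettes at height `k`
  set x : G := U (vsite M (k : ZMod L), a) * U (vsite A (k : ZMod L), 2) *
    (U (vsite M ((k : ZMod L) + 1), a))⁻¹ with hx
  set y : G := (U (vsite B ((k : ZMod L) + 1), a))⁻¹ * (U (vsite B (k : ZMod L), 2))⁻¹ *
    U (vsite B (k : ZMod L), a) with hy
  have hM' : ∀ s : G, WilsonRP.plaqRe ρ (update U e s) (vsite M (k : ZMod L), pl) =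
      reTr ρ (x * s⁻¹) := fun s => by
    rw [plaqRe_rung ρ pl hpl M, ← ha_def, ← hA, hhor, hhor, hcol s hAM, ← he, update_self]
  have hB' : ∀ s : G, WilsonRP.plaqRe ρ (update U e s) (vsite B (k : ZMod L), pl) =
      reTr ρ (s * y) := fun s => by
    rw [plaqRe_rung ρ pl hpl B, ← ha_def, ← hM, hhor, hhor, hcol s hMB.symm, ← he, update_self,
      hy, mul_assoc (U (vsite B (k : ZMod L), a)) s, mul_assoc (U (vsite B (k : ZMod L), a)),
      reTr_mul_comm ρ (U (vsite B (k : ZMod L), a))]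
    congr 1
    group
  -- splitting off height `k`
  have hsplit : ∀ V : GaugeConfig 3 L G, ∏ i ∈ Ico k L,
      (WilsonRP.plaqRe ρ V (vsite M (i : ZMod L), pl) * WilsonRP.plaqRe ρ V (vsite B (i : ZMod L), pl)) =
      (WilsonRP.plaqRe ρ V (vsite M (k : ZMod L), pl) * WilsonRP.plaqRe ρ V (vsite B (k : ZMod L), pl)) *
        ∏ i ∈ Ico (k + 1) L, (WilsonRP.plaqRe ρ V (vsite M (i : ZMod L), pl) *
          WilsonRP.plaqRe ρ V (vsite B (i : ZMod L), pl)) := fun V =>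
    prod_eq_prod_Ico_succ_bot hkL _
  set R : ℝ := polRe ρ 2 U (vsite A 0) * polRe ρ 2 U (vsite B 0) *
    (∏ i ∈ range k, reTr ρ (rectWord pl B (i : ZMod L) U)) *
    ∏ i ∈ Ico (k + 1) L, (WilsonRP.plaqRe ρ U (vsite M (i : ZMod L), pl) *
      WilsonRP.plaqRe ρ U (vsite B (i : ZMod L), pl)) with hR
  have hF : ∀ s : G, midIntegrand ρ pl B k (update U e s) =
      R * (reTr ρ (x * s⁻¹) * reTr ρ (s * y)) := fun s => by
    unfold midIntegrand
    rw [← ha_def, ← hM, ← hA, hsplit, hpairs, hM', hB', hP s hAM, hP s hMB.symm]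
    simp_rw [hrect]
    rw [hR]
    ring
  simp_rw [hF]
  rw [integral_const_mul, hR1 x y]
  -- `Re χ(x y)` is the rectangle at height `k`
  have hword : reTr ρ (x * y) = reTr ρ (rectWord pl B (k : ZMod L) U) := by
    unfold rectWord
    rw [← ha_def, ← hM, ← hA, hx, hy]
    rw [show U (vsite M (k : ZMod L), a) * U (vsite A (k : ZMod L), 2) *
        (U (vsite M ((k : ZMod L) + 1), a))⁻¹ * ((U (vsite B ((k : ZMod L) + 1), a))⁻¹ *
          (U (vsite B (k : ZMod L), 2))⁻¹ * U (vsite B (k : ZMod L), a)) =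
        (U (vsite M (k : ZMod L), a) * U (vsite A (k : ZMod L), 2) *
          (U (vsite M ((k : ZMod L) + 1), a))⁻¹ * (U (vsite B ((k : ZMod L) + 1), a))⁻¹ *
          (U (vsite B (k : ZMod L), 2))⁻¹) * U (vsite B (k : ZMod L), a) by group,
      reTr_mul_comm ρ _ (U (vsite B (k : ZMod L), a))]
    congr 1
    group
  rw [hword]
  -- and the stage-`(k+1)` integrand
  unfold midIntegrand
  rw [← ha_def, ← hM, ← hA, prod_range_succ, hR]
  ring

/-- **Iterating**: `∫ mid_0 = c₁^k ∫ mid_k` for `k ≤ L`. -/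
theorem mid_iterate (hpl : pl.1.2 = 2) (hρ : Continuous ρ) (hL : 3 ≤ L) {c₁ : ℝ}
    (hR1 : ∀ x y : G, ∫ g, reTr ρ (x * g⁻¹) * reTr ρ (g * y) ∂haarProbability G =
      c₁ * reTr ρ (x * y)) :
    ∀ k : ℕ, k ≤ L →
      ∫ U, midIntegrand ρ pl B 0 U ∂Measure.pi (fun _ : Edge 3 L => haarProbability G) =
        c₁ ^ k * ∫ U, midIntegrand ρ pl B k U ∂Measure.pi (fun _ : Edge 3 L => haarProbability G)
  | 0, _ => by simp
  | k + 1, hk => by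
    rw [mid_iterate hpl hρ hL hR1 k (by omega), mid_succ ρ pl B hpl hρ hL hR1 (by omega), pow_succ,
      mul_assoc]

/-- **The band integral is `c₁^L` times the rectangle integral.** -/
theorem bandIntegral_eq_pow_mul_rectIntegral (hpl : pl.1.2 = 2) (hρ : Continuous ρ) (hL : 3 ≤ L)
    {c₁ : ℝ} (hR1 : ∀ x y : G, ∫ g, reTr ρ (x * g⁻¹) * reTr ρ (g * y) ∂haarProbability G =
      c₁ * reTr ρ (x * y)) :
    bandIntegral ρ pl B = c₁ ^ L * rectIntegral ρ pl B := by
  have h0 : bandIntegral ρ pl B =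
      ∫ U, midIntegrand ρ pl B 0 U ∂Measure.pi (fun _ : Edge 3 L => haarProbability G) := by
    unfold bandIntegral
    exact integral_congr_ae (ae_of_all _ fun U => (midIntegrand_zero ρ pl B U).symm)
  have hL' : rectIntegral ρ pl B =
      ∫ U, midIntegrand ρ pl B L U ∂Measure.pi (fun _ : Edge 3 L => haarProbability G) := by
    unfold rectIntegral
    exact integral_congr_ae (ae_of_all _ fun U => (midIntegrand_last ρ pl B U).symm)
  rw [h0, hL', mid_iterate ρ pl B hpl hρ hL hR1 L le_rfl]

end Middle

end DiagRPSUN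

end

end Summit.QuantumFields.GaugeBoot
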